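import Literature.IUT.HodgeArakelov.TemperedThetaMonoidsSubdagStatements
import Literature.IUT.HodgeArakelov.TemperedThetaMonoidsProofs2
import Literature.IUT.HodgeArakelov.TemperedThetaMonoidsProofs4

/-!
# [IUTchII] §3, Propositions 3.1, 3.3, 3.4 — sub-DAG W6-S6: the typed junctions of
# `TemperedThetaMonoidsSubdagStatements.lean` CONNECTED to the landed proof companions (closers)

S. Mochizuki, *Inter-universal Teichmüller theory II*, §3 (kurims Dec-2020 manuscript), Prop. 3.1 (i)(ii)
pp. 87–88, Prop. 3.3 (i)(ii) pp. 89–90, Prop. 3.4 (ii) pp. 92–93 [cite: Mochizuki2012, Prop 3.1 p.87]. Claim key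
DISPUTED (D-0012). PROOF-ONLY companion (abc-iut cell, D-0068 (1) sub-DAG W6-S6, seat abc-iut-w5-d169; DAG nodes
IUTchII:Prop3.1(i), IUTchII:Prop3.1(ii), IUTchII:Prop3.3(i), IUTchII:Prop3.3(ii), IUTchII:Prop3.4(ii)). No definition,
no new named fact; nothing takes a side on [IUTchIII] Cor. 3.12.  Each theorem says that a junction `Prop` of the
statements file (J2, J4, J6/J9, J13) is EXACTLY what a landed companion consumes or produces:

* J2 `ThetaEnvData.ThetaEnvPermuted` + unit stability ⟹ the field `Prop31Statements.conj_permutes`, for `Ψ^ι_env` AND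
  `∞Ψ^ι_env` (abc-iut-L6-d3 `thetaMonoid_map_conj` / `inftyThetaMonoid_map_conj`, p405901);
* J4 `ThetaEnvData.KummerInput A Pc E` ⟹ `Ψ_cns` conjugation-stable, `Ψ_cns ⥲ M_TM(Π_X(M^Θ_*))` inverting the Kummer map,
  and `Ψ_cns ⥲ O^⊳(G_v(M^Θ_*))` (abc-iut-w4-d019/d007 `TemperedThetaMonoidsProofs2.lean` p411791/p411800) — Prop. 3.1 (ii)
  «naturally isomorphic to `O^▷_{F̄_v}` … equipped with a natural conjugation action»;
* J6 ⟹ J9: a Kummer-induced datum with `Π_X(M^Θ_*)`-equivariant Kummer map satisfies the compatibility law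
  `Prop33KummerStatements.IsEquivariant` — Prop. 3.3 «compatible with … the respective conjugation actions»;
* J8 in the vocabulary of J6: the inhabitant of `exists_prop33KummerStatements_of_kummer` (p414222) IS Kummer-induced;
* J14 ⟹ J13: `Prop34iiUniradialContent A G` from the named facts `Rmk1111_a/_b` (p414222's
  `prop34ii_uniradialContent_of_rmk1111`, restated through the def) — Prop. 3.4 (ii).
-/

namespace Literature.IUT.HodgeArakelov

namespace TemperedThetaMonoids

open CategoryTheory

universe u v

/-! ### J2 closes `Prop31Statements.conj_permutes` (both `Ψ` and `∞Ψ`) -/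

section J2

variable {P : Type u} [Group P] (E : ThetaEnvData.{u, v} P)

/-- **IUTchII:Prop3.1(i)** (kurims p. 87 «this collection of subsets is equipped with a natural conjugation action by
`Π_X(M^Θ_*)`»): under J2 (`ThetaEnvPermuted`) and stability of `M^×_TM`, the conjugation action permutes BOTH families
of theta monoids `{Ψ^ι_env}_ι`, `{∞Ψ^ι_env}_ι`, with the SAME re-indexing `ι ↦ ι'`. [cite: Mochizuki2012, Prop 3.1 (i) p.87] -/
theorem ThetaEnvData.conj_permutes_both_of_thetaEnvPermuted (hperm : E.ThetaEnvPermuted)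
    (hU : ∀ (g : P) (x : E.H), x ∈ E.units → E.conj g x ∈ E.units) (g : P) (ι : E.Iota) :
    ∃ ι' : E.Iota, (E.thetaMonoid ι).map (E.conj g).toMonoidHom = E.thetaMonoid ι' ∧
      (E.inftyThetaMonoid ι).map (E.conj g).toMonoidHom = E.inftyThetaMonoid ι' := by
  obtain ⟨ι', h₁, h₂⟩ := hperm g ι
  exact ⟨ι', thetaMonoid_map_conj E g hU h₁, inftyThetaMonoid_map_conj E g hU h₂⟩

/-- J2 implies the hypothesis `hperm` of abc-iut-L6-d3's `prop31Statements_of_val` (the `θ^ι_env`-half).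
[cite: Mochizuki2012, Prop 3.1 (i) p.87] -/
theorem ThetaEnvData.hperm_of_thetaEnvPermuted (hperm : E.ThetaEnvPermuted) :
    ∀ (g : P) (ι : E.Iota), ∃ ι' : E.Iota, E.conj g '' E.thetaEnv ι = E.thetaEnv ι' :=
  fun g ι => (hperm g ι).imp fun _ h => h.1

end J2

/-! ### J4 feeds `TemperedThetaMonoidsProofs2.lean` (Prop 3.1 (ii)) -/

section J4

variable {S : ThetaSetting.{u}} (A : AbsTopMonoids S) (Pc : IsoClass S.PiX) (E : ThetaEnvData.{u, v} Pc.G)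

/-- **IUTchII:Prop3.1(ii)** (kurims p. 88): under J4 (`KummerInput`, = GAP-LEDGER G-w4d019-1 bundled), the constant
monoid `Ψ_cns(M^Θ_*)` is stable under the conjugation action of `Π_X(M^Θ_*)` («equipped with a natural conjugation
action»), is isomorphic to `M_TM(Π_X(M^Θ_*))` by an isomorphism inverting the Kummer map, and is «naturally isomorphic
to `O^▷_{F̄_v}` [cf. Example 1.8, (ii)]» = `O^⊳(G_v(M^Θ_*))` at `G_v = Π_X/Δ`, EQUIVARIANTLY — the three conclusions of
abc-iut-w4-d019's companion, now from the single junction `Prop`. [cite: Mochizuki2012, Prop 3.1 (ii) p.88] -/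
theorem ThetaEnvData.prop31ii_of_kummerInput (h : E.KummerInput A Pc) :
    E.IsConjStable E.constantMonoid ∧
      (∃ κ : A.MTM Pc →* E.H, Function.Injective κ ∧
        ∃ e : E.constantMonoid ≃* A.MTM Pc, ∀ c : E.constantMonoid, κ (e c) = (c : E.H)) ∧
      ∃ e : E.constantMonoid ≃* A.Otri ⟨TopGroup.quot Pc.G (A.Delta Pc), A.quotIso Pc⟩,
        ∀ (x : Pc.G) (c : E.constantMonoid) (hc : E.conj x (c : E.H) ∈ E.constantMonoid),
          e ⟨E.conj x c, hc⟩ =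
            A.actOtri ⟨TopGroup.quot Pc.G (A.Delta Pc), A.quotIso Pc⟩ (QuotientGroup.mk x) (e c) := by
  obtain ⟨κ, hκ, hκeq, hcns⟩ := h
  refine ⟨constantMonoid_isConjStable_of_kummer A Pc E κ hcns hκeq, ⟨κ, hκ, ?_⟩, ?_⟩
  · obtain ⟨e, he, -⟩ := exists_constantMonoid_mulEquiv_MTM A Pc E κ hκ hcns
    exact ⟨e, he⟩
  · obtain ⟨e, -, he⟩ := exists_constantMonoid_mulEquiv_Otri A Pc E κ hκ hcns hκeq
    exact ⟨e, fun x c hc => he x c⟩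

end J4

/-! ### J6 ⟹ J9, and J8 is Kummer-induced (Prop 3.3) -/

section J6

variable {P : Type u} [Group P] (E : ThetaEnvData.{u, v} P) (F : TemperedFrobenioidThetaData.{u, v} P)

/-- **IUTchII:Prop3.3(i)(ii)** (kurims p. 90 «compatible with … the respective conjugation actions by `Π_X(M^Θ_*)`»): a
Kummer-induced datum (J6) whose Kummer map is `Π_X(M^Θ_*)`-equivariant satisfies the compatibility law J9.
[cite: Mochizuki2012, Prop 3.3 p.90] -/
theorem Prop33KummerStatements.isEquivariant_of_isKummerInduced (K : Prop33KummerStatements E F)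
    (k : F.K →* E.H) (hK : K.IsKummerInduced k)
    (hequiv : ∀ (g : P) (x : F.K), k (F.conj g x) = E.conj g (k x)) : K.IsEquivariant := by
  obtain ⟨h₁, h₂, h₃⟩ := hK
  refine ⟨fun β α x hx => ?_, fun β α x hx => ?_, fun β x hx => ?_⟩
  · rw [h₁, h₁, hequiv]
  · rw [h₂, h₂, hequiv]
  · rw [h₃, h₃, hequiv]

/-- **IUTchII:Prop3.3(i)(ii)** (kurims p. 90 «By forming Kummer classes …»): the EXISTENCE theorem
`exists_prop33KummerStatements_of_kummer` (p414222) in the vocabulary of the statements file — under its hypotheses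
there is a datum `K` with the prescribed labels which is Kummer-induced by `k` (J6) and, if `k` is
`Π_X(M^Θ_*)`-equivariant, satisfies the compatibility law (J9). [cite: Mochizuki2012, Prop 3.3 p.90] -/
theorem exists_prop33KummerStatements_isKummerInduced (k : F.K →* E.H) (hk : Function.Injective k)
    (hU : F.units.toSubmonoid.map k = E.units.toSubmonoid) (hC : F.baseMonoid.map k = E.constantMonoid)
    (ι : P → E.Iota) (hθ : ∀ α : P, k (F.conj α F.theta) ∈ E.thetaEnv (ι α))
    (hθ' : ∀ α : P, E.thetaEnv (ι α) ⊆
      (splitMonoid E.units (Submonoid.powers (k (F.conj α F.theta))) : Set E.H))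
    (hinf : ∀ α : P, E.inftyThetaEnv (ι α) ⊆
      (splitMonoid E.units ((rootPowers (F.conj α F.theta)).map k) : Set E.H))
    (hinf' : ∀ α : P, ((rootPowers (F.conj α F.theta)).map k : Set E.H) ⊆ E.inftyThetaMonoid (ι α)) :
    ∃ K : Prop33KummerStatements E F, K.label = ι ∧ K.IsKummerInduced k ∧
      ((∀ (g : P) (x : F.K), k (F.conj g x) = E.conj g (k x)) → K.IsEquivariant) := by
  obtain ⟨K, hlab, h₁, h₂, h₃, -⟩ :=
    exists_prop33KummerStatements_of_kummer E F k hk hU hC ι hθ hθ' hinf hinf'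
  subst hlab
  exact ⟨K, rfl, ⟨h₁, h₂, h₃⟩, fun hequiv =>
    Prop33KummerStatements.isEquivariant_of_isKummerInduced E F K k ⟨h₁, h₂, h₃⟩ hequiv⟩

end J6

/-! ### J14 ⟹ J13 (Prop 3.4 (ii)) -/

section J13

variable {S : ThetaSetting.{u}} (A : AbsTopMonoids S)

/-- **IUTchII:Prop3.4(ii)** (kurims pp. 92–93 «fails to be compatible … only admits a uniradial formulation»): the
typed content J13 (`Prop34iiUniradialContent A G`) HOLDS given the named facts `Rmk1111_a` ([AbsTopIII] Prop. 3.2 (iv))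
and `Rmk1111_b` ([AbsTopIII] Prop. 3.3 (ii)) of Remark 1.11.1 (i), the compatibility of the `Ẑ^×`-action on `O^×(G)`
with `Ẑ^× → Ism(G) ↷ O^{×μ}(G)`, and one `u ∈ Ẑ^×` acting non-trivially on `O^{×μ}(G)` — p414222's
`prop34ii_uniradialContent_of_rmk1111`, read through the def. CONDITIONAL on the two named facts by design.
[cite: Mochizuki2012, Prop 3.4 (ii) p.92] -/
theorem prop34iiUniradialContent_of_rmk1111
    (zhatPow : ∀ G : IsoClass S.Gk, ZHatUnits →* MulAut (A.Ounits G))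
    (ha : Rmk1111_a A) (hb : Rmk1111_b A zhatPow) (G : IsoClass S.Gk)
    (hcompat : ∀ (u : ZHatUnits) (x : A.Ounits G),
      (QuotientGroup.mk (zhatPow G u x) : A.Oxmu G) = A.actIsm G (A.toIsm G u) (QuotientGroup.mk x))
    (u : ZHatUnits) (hu : A.actIsm G (A.toIsm G u) ≠ 1) : Prop34iiUniradialContent A G :=
  prop34ii_uniradialContent_of_rmk1111 A zhatPow ha hb G hcompat u hu

/-- **IUTchII:Prop3.4(ii)** (kurims pp. 92–93 «[cf. Remarks 1.11.1, (i), (b); 1.8.1]»), STRONG FORM over ALL of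
`Aut(G)`: with, in addition, abc-iut-L6-t1's named fact `Rmk181_statement` (Remark 1.8.1: no automorphism of
`O^{×μ}(G)` induced by an element of `Aut(G)` coincides with one induced by a unit of `Ẑ` acting non-trivially),
the `Ẑ^×`-automorphism `ψ` of the coric pair `G ↷ O^{×μ}(G)` induced from `G ↷ O^×(G)` is induced by NO automorphism
of the TM-pair `G ↷ O^⊳(G)` WHATSOEVER (over any `σ ∈ Aut(G)`, not only over `1`): by `Rmk1111_a` the pair-automorphism
over `σ` is `(σ, O^⊳(σ))` (functoriality `mapOtri`), whose action on `O^{×μ}(G)` differs from `ψ` by Remark 1.8.1.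
CONDITIONAL on the three named facts by design. [cite: Mochizuki2012, Prop 3.4 (ii) p.92] -/
theorem prop34iiUniradialContent_strong_of_rmk1111_rmk181
    (zhatPow : ∀ G : IsoClass S.Gk, ZHatUnits →* MulAut (A.Ounits G))
    (ha : Rmk1111_a A) (hb : Rmk1111_b A zhatPow) (h181 : Rmk181_statement A) (G : IsoClass S.Gk)
    (hcompat : ∀ (u : ZHatUnits) (x : A.Ounits G),
      (QuotientGroup.mk (zhatPow G u x) : A.Oxmu G) = A.actIsm G (A.toIsm G u) (QuotientGroup.mk x))
    (u : ZHatUnits) (hu : A.actIsm G (A.toIsm G u) ≠ 1) :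
    ∃ ψ : MulAut (A.Oxmu G),
      (∀ (g : G.G) (x : A.Oxmu G), ψ (A.actOxmu G g x) = A.actOxmu G g (ψ x)) ∧
      (∃ p : PairAut G (A.Ounits G) (A.actOunits G), PairAut.forget p = 1 ∧
          ∀ x : A.Ounits G, (QuotientGroup.mk (p.1.2 x) : A.Oxmu G) = ψ (QuotientGroup.mk x)) ∧
      ∀ q : PairAut G (A.Otri G) (A.actOtri G),
          ∃ x : A.Ounits G,
            (QuotientGroup.mk (Units.map q.1.2.toMonoidHom x) : A.Oxmu G) ≠ ψ (QuotientGroup.mk x) := by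
  -- `ψ := actIsm G (toIsm G u)`, induced by the pair-automorphism `(1, zhatPow G u)` of `G ↷ O^×(G)` ((b))
  obtain ⟨_, _, hpair⟩ := hb G
  refine ⟨A.actIsm G (A.toIsm G u), ?_, ⟨⟨((1 : Aut G), zhatPow G u), hpair u⟩, rfl, fun x => hcompat u x⟩, ?_⟩
  · intro g x
    obtain ⟨y, rfl⟩ := QuotientGroup.mk_surjective x
    have hlin : zhatPow G u (A.actOunits G g y) = A.actOunits G g (zhatPow G u y) := hpair u g y
    change A.actIsm G (A.toIsm G u) (A.actOxmu G g (QuotientGroup.mk y)) =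
      A.actOxmu G g (A.actIsm G (A.toIsm G u) (QuotientGroup.mk y))
    rw [AbsTopMonoids.actOxmu, QuotientGroup.map_mk, ← hcompat, ← hcompat, QuotientGroup.map_mk]
    exact congrArg _ hlin
  · intro q
    -- the pair-automorphism over `σ := forget q` is `(σ, mapOtri σ.hom)` by functoriality + (a)
    let σ : Aut G := PairAut.forget q
    have hp₀ : ((σ, A.mapOtri σ.hom) : Aut G × MulAut (A.Otri G)) ∈ PairAut G (A.Otri G) (A.actOtri G) :=
      fun g m => A.mapOtri_equivariant σ.hom g m
    have hq : q = ⟨(σ, A.mapOtri σ.hom), hp₀⟩ := (ha G).1 rfl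
    have h := h181 G σ.hom u hu
    rw [not_forall] at h
    obtain ⟨x, hx⟩ := h
    refine ⟨x, ?_⟩
    rw [hq]
    exact hx

end J13

end TemperedThetaMonoids

end Literature.IUT.HodgeArakelov
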